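import Summits.AtomisticToContinuum.FouriersLaw.Theses.PhononMeanFreePath
import Summits.AtomisticToContinuum.FouriersLaw.Theorems.BoundaryKubo.Negative.LoadBearing
import Summits.AtomisticToContinuum.FouriersLaw.Theorems.BondHeatUncertaintySubdiffusiveBondHeatKernelGibbsC
import Literature.MathematicalPhysics.KineticTheory.LangevinChainDynkin
import Mathlib.Probability.Kernel.Composition.IntegralCompProd

/-!
# Gibbs-tested TTCF identity, helper 2: Lebesgue duality of the pinned-chain kernels against Gibbs weights
(helpers for stub `stub_gibbsTTCF` of line `gibbs-ttcf`, crux stmt-AtomisticToContinuum-11812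
`PhononMeanFreePath.BoundaryKubo`)

For the pinned anharmonic chain `P = pinnedChain ω₂ lam β γ` (`ω₂ > 0`, `lam, β, γ ≥ 0`) with `N ≥ 1` sites and
bath temperatures `T_L, T_R > 0`, forward kernels `P_s = transitionKernel` (`= langevinKernel`, part A of
`…KernelGibbs`) and reversed kernels `P̂_s = langevinRevKernel`:

* `abs_sq_momentum_le_exp`, `stronglyMeasurable_integral_langevinRevKernel` — `|p_i²| ≤ (2/θ)e^{θH}`; joint
  measurability of `(s, y) ↦ P̂_{s⁺} g(y)`;
* `pinnedChain_integrable_transitionKernel_of_abs_le_exp` — (3.4) in Bochner form: a continuous `|f| ≤ C_f e^{θH}`,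
  `0 < θ < 1/max(T_L,T_R)`, is `P_s(z,·)`-integrable with `∫ |f| dP_s(z,·) ≤ C_f e^{θγ(T_L+T_R)s} e^{θH(z)}`;
* `pinnedChain_gibbs_duality` — for continuous `|w|, |f| ≤ const·e^{θH}` with moreover `2θ < 1/T` and `s > 0`:
  `∫ w ρ_T (P_s f) dx = e^{2γs} ∫ f · P̂_s(w ρ_T) dy` (`ρ_T = e^{-H/T}`), together with the integrability of
  `y ↦ |f(y)| P̂_s(|w| ρ_T)(y)` and the bound `∫ |f| P̂_s(|w|ρ_T) dy ≤ e^{-2γs} C_w C_f e^{θγ(T_L+T_R)s} ∫ e^{2θH}ρ_T`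
  (`OscillatorChain.IsConfining.integral_langevinKernel_duality` for `H(x,y) = w(x)ρ_T(x)f(y)`, which is
  integrable for `dx ⊗ P_s` by (3.4) and `e^{2θH}ρ_T ∈ L¹`).
-/

noncomputable section

open scoped NNReal ENNReal Topology
open MeasureTheory Filter Set

namespace Summit.AtomisticToContinuum.FouriersLaw.Theorems.BoundaryKubo.GibbsTtcf

open Literature.MathematicalPhysics.KineticTheory.HeatConduction
open Literature.MathematicalPhysics.KineticTheory Literature.Probability.Process OscillatorChain
open ProbabilityTheory
open Summit.AtomisticToContinuum.FouriersLaw.Theorems.SubdiffusiveBondHeat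

variable {P : OscillatorChain} in
/-- `|p_i²| ≤ (2/θ) e^{θH}` for a chain with nonnegative potentials and `θ > 0` (`p_i² ≤ 2H`, `θH + 1 ≤ e^{θH}`).
[folklore] -/
theorem abs_sq_momentum_le_exp (hP : P.IsConfining) {θ : ℝ} (hθ : 0 < θ) (N : ℕ) (z : PhaseSpace N)
    (i : Fin N) : |z.2 i ^ 2| ≤ 2 / θ * Real.exp (θ * P.hamiltonian N z) := by
  have hk := P.kinetic_le_hamiltonian_of_nonneg hP.U_nonneg hP.V_nonneg N z
  have h2 : z.2 i ^ 2 / 2 ≤ ∑ j, z.2 j ^ 2 / 2 :=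
    Finset.single_le_sum (f := fun j => z.2 j ^ 2 / 2) (fun j _ => by positivity) (Finset.mem_univ _)
  have hH : θ * P.hamiltonian N z + 1 ≤ Real.exp (θ * P.hamiltonian N z) := Real.add_one_le_exp _
  rw [abs_of_nonneg (sq_nonneg _), div_mul_eq_mul_div, le_div_iff₀ hθ]
  nlinarith [mul_le_mul_of_nonneg_left (show z.2 i ^ 2 ≤ 2 * P.hamiltonian N z by linarith) hθ.le]

variable {P : OscillatorChain} in
/-- **Joint measurability of the reversed kernels in time and space**: for strongly measurable `g`,
`(s, y) ↦ ∫ g dP̂_{s⁺}(y, ·)` is strongly measurable (`ConfinedDrift.measurable_sdeKernel` for the reversed drift,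
packaged as one kernel on `ℝ≥0 × Ω`). [folklore] -/
theorem stronglyMeasurable_integral_langevinRevKernel (hP : P.IsConfining) (N : ℕ) (T_L T_R : ℝ)
    {g : PhaseSpace N → ℝ} (hg : StronglyMeasurable g) :
    StronglyMeasurable fun q : ℝ × PhaseSpace N =>
      ∫ x, g x ∂(P.langevinRevKernel N T_L T_R q.1.toNNReal q.2) := by
  have hv₁ := hP.bathVecL_mem_reversedDrift_noise N T_L
  have hv₂ := hP.bathVecR_mem_reversedDrift_noise N T_R
  let κ₂ : Kernel (ℝ≥0 × PhaseSpace N) (PhaseSpace N) :=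
    { toFun := fun p => P.langevinRevKernel N T_L T_R p.1 p.2
      measurable' := (hP.reversedDrift N).toConfinedDrift.measurable_sdeKernel hv₁ hv₂ }
  have h1 : StronglyMeasurable fun p : ℝ≥0 × PhaseSpace N => ∫ x, g x ∂(κ₂ p) :=
    hg.integral_kernel (κ := κ₂)
  have h2 : StronglyMeasurable fun q : ℝ × PhaseSpace N => ∫ x, g x ∂(κ₂ (q.1.toNNReal, q.2)) :=
    h1.comp_measurable ((measurable_real_toNNReal.comp measurable_fst).prodMk measurable_snd)
  exact h2

section Pinned

variable {ω₂ lam β γ : ℝ} (hω : 0 < ω₂) (hl : 0 ≤ lam) (hβ : 0 ≤ β) (hγ : 0 ≤ γ) {N : ℕ} (hN : 0 < N)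
  {T_L T_R : ℝ} (hTL : 0 < T_L) (hTR : 0 < T_R)
include hω hl hβ hγ hN hTL hTR

/-- **(3.4) in Bochner form.** A continuous `f` with `|f| ≤ C_f e^{θH}`, `0 < θ < 1/max(T_L, T_R)`, is integrable
for the transition kernels `P_s(z, ·)` of the pinned chain and `∫ |f| dP_s(z,·) ≤ C_f e^{θγ(T_L+T_R)s} e^{θH(z)}`.
[cite: CuneoEckmannHairerReyBellet2018, §3 eq. (3.4)] -/
theorem pinnedChain_integrable_transitionKernel_of_abs_le_exp {θ Cf : ℝ} (hθ : 0 < θ)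
    (hθ' : θ < 1 / max T_L T_R) {f : PhaseSpace N → ℝ} (hf : Continuous f)
    (hfb : ∀ y, |f y| ≤ Cf * Real.exp (θ * (pinnedChain ω₂ lam β γ).hamiltonian N y)) (s : ℝ≥0)
    (z : PhaseSpace N) :
    Integrable f ((pinnedChain ω₂ lam β γ).transitionKernel N T_L T_R s z) ∧
    ∫ y, |f y| ∂((pinnedChain ω₂ lam β γ).transitionKernel N T_L T_R s z) ≤
      Cf * Real.exp (θ * γ * (T_L + T_R) * s) * Real.exp (θ * (pinnedChain ω₂ lam β γ).hamiltonian N z) := by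
  set P := pinnedChain ω₂ lam β γ with hP
  set κ := P.transitionKernel N T_L T_R s z with hκ
  haveI : IsProbabilityMeasure κ :=
    (pinnedChain_isMarkovKernel_transitionKernel hω hl hβ hγ N T_L T_R s).isProbabilityMeasure z
  have h34 := lintegral_exp_mul_hamiltonian_pinnedChainSemigroup_le hω hl hβ hγ hN hTL.le hTR.le hTL hTR hθ
    hθ' s z
  have hexpc : Continuous fun y => Real.exp (θ * P.hamiltonian N y) :=
    Real.continuous_exp.comp (continuous_const.mul (pinnedChain_continuous_hamiltonian ω₂ lam β γ N))
  have hexpint : Integrable (fun y => Real.exp (θ * P.hamiltonian N y)) κ := by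
    refine ⟨hexpc.aestronglyMeasurable, ?_⟩
    rw [hasFiniteIntegral_iff_ofReal (Eventually.of_forall fun y => (Real.exp_pos _).le)]
    exact lt_of_le_of_lt h34 ENNReal.ofReal_lt_top
  have hexpval : ∫ y, Real.exp (θ * P.hamiltonian N y) ∂κ ≤
      Real.exp (θ * γ * (T_L + T_R) * s) * Real.exp (θ * P.hamiltonian N z) := by
    rw [integral_eq_lintegral_of_nonneg_ae (Eventually.of_forall fun y => (Real.exp_pos _).le)
      hexpc.aestronglyMeasurable]
    have := ENNReal.toReal_mono ENNReal.ofReal_ne_top h34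
    rwa [ENNReal.toReal_ofReal (by positivity)] at this
  have hCf : 0 ≤ Cf := by
    have h := (abs_nonneg _).trans (hfb z)
    exact nonneg_of_mul_nonneg_left h (Real.exp_pos _)
  have hfint : Integrable f κ := (hexpint.const_mul Cf).mono' hf.aestronglyMeasurable
    (Eventually.of_forall fun y => by rw [Real.norm_eq_abs]; exact hfb y)
  refine ⟨hfint, ?_⟩
  calc ∫ y, |f y| ∂κ ≤ ∫ y, Cf * Real.exp (θ * P.hamiltonian N y) ∂κ :=
        integral_mono hfint.abs (hexpint.const_mul Cf) hfb
    _ = Cf * ∫ y, Real.exp (θ * P.hamiltonian N y) ∂κ := integral_const_mul _ _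
    _ ≤ Cf * (Real.exp (θ * γ * (T_L + T_R) * s) * Real.exp (θ * P.hamiltonian N z)) :=
        mul_le_mul_of_nonneg_left hexpval hCf
    _ = _ := by ring

/-- **Lebesgue duality of the pinned-chain kernels against Gibbs weights.** For `T > 0`, `0 < θ < 1/max(T_L,T_R)`
with `2θ < 1/T`, continuous `|w| ≤ C_w e^{θH}`, `|f| ≤ C_f e^{θH}`, `ρ_T = e^{-H/T}` and `s > 0`:
(i) `y ↦ |f(y)| ∫ |w| ρ_T dP̂_s(y,·)` is Lebesgue integrable,
(ii) `∫ |f| P̂_s(|w|ρ_T) dy ≤ e^{-2γs} C_w C_f e^{θγ(T_L+T_R)s} ∫ e^{2θH} ρ_T dx`, and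
(iii) `∫ w ρ_T (P_s f) dx = e^{2γs} ∫ f · P̂_s(w ρ_T) dy`
(`dx P_s(x,dy) = e^{2γs} dy P̂_s(y,dx)`, `LangevinChainReversal`, applied to `H(x,y) = w(x)ρ_T(x)f(y)`, integrable
for `dx ⊗ P_s` by (3.4) and `e^{2θH}ρ_T ∈ L¹(dx)`). [folklore] -/
theorem pinnedChain_gibbs_duality {T θ Cw Cf : ℝ} (hT : 0 < T) (hθ : 0 < θ) (hθ' : θ < 1 / max T_L T_R)
    (h2θ : 2 * θ < 1 / T) {w f : PhaseSpace N → ℝ} (hw : Continuous w) (hf : Continuous f)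
    (hwb : ∀ x, |w x| ≤ Cw * Real.exp (θ * (pinnedChain ω₂ lam β γ).hamiltonian N x))
    (hfb : ∀ y, |f y| ≤ Cf * Real.exp (θ * (pinnedChain ω₂ lam β γ).hamiltonian N y)) {s : ℝ≥0}
    (hs : 0 < s) :
    Integrable (fun y => |f y| * ∫ x, |w x| * (pinnedChain ω₂ lam β γ).gibbsDensity N T x
        ∂((pinnedChain ω₂ lam β γ).langevinRevKernel N T_L T_R s y)) ∧
    ∫ y, |f y| * ∫ x, |w x| * (pinnedChain ω₂ lam β γ).gibbsDensity N T x
        ∂((pinnedChain ω₂ lam β γ).langevinRevKernel N T_L T_R s y) ≤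
      Real.exp (-(2 * γ * s)) * (Cw * Cf * Real.exp (θ * γ * (T_L + T_R) * s) *
        ∫ x, Real.exp (2 * θ * (pinnedChain ω₂ lam β γ).hamiltonian N x) *
          (pinnedChain ω₂ lam β γ).gibbsDensity N T x) ∧
    ∫ x, w x * (pinnedChain ω₂ lam β γ).gibbsDensity N T x *
        (∫ y, f y ∂((pinnedChain ω₂ lam β γ).transitionKernel N T_L T_R s x)) =
      Real.exp (2 * γ * s) * ∫ y, f y * ∫ x, w x * (pinnedChain ω₂ lam β γ).gibbsDensity N T x
        ∂((pinnedChain ω₂ lam β γ).langevinRevKernel N T_L T_R s y) := by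
  set P := pinnedChain ω₂ lam β γ with hPdef
  have hP : P.IsConfining := pinnedChain_isConfining hω hl hβ hγ
  set ρ := P.gibbsDensity N T with hρdef
  set K := P.langevinKernel N T_L T_R s with hK
  set Kr := P.langevinRevKernel N T_L T_R s with hKr
  have hKt : P.transitionKernel N T_L T_R s = K :=
    (pinnedChain_langevinKernel_eq_transitionKernel N T_L T_R hω hl hβ hγ s).symm
  haveI : IsMarkovKernel K := hP.isMarkovKernel_langevinKernel N T_L T_R s
  haveI : IsMarkovKernel Kr := hP.isMarkovKernel_langevinRevKernel N T_L T_R s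
  have hHc : Continuous (P.hamiltonian N) := pinnedChain_continuous_hamiltonian ω₂ lam β γ N
  have hρc : Continuous ρ := pinnedChain_continuous_gibbsDensity ω₂ lam β γ N T
  have hρ0 : ∀ x, 0 ≤ ρ x := fun x => (P.gibbsDensity_pos N T x).le
  have hCw : 0 ≤ Cw := nonneg_of_mul_nonneg_left ((abs_nonneg _).trans (hwb 0)) (Real.exp_pos _)
  have hCf : 0 ≤ Cf := nonneg_of_mul_nonneg_left ((abs_nonneg _).trans (hfb 0)) (Real.exp_pos _)
  set cst := Real.exp (θ * γ * (T_L + T_R) * s) with hcst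
  -- (3.4) for `f` and `|f|` under the forward kernels
  have h34 : ∀ x, Integrable f (K x) ∧ ∫ y, |f y| ∂(K x) ≤ Cf * cst * Real.exp (θ * P.hamiltonian N x) := by
    intro x
    have h := pinnedChain_integrable_transitionKernel_of_abs_le_exp hω hl hβ hγ hN hTL hTR hθ hθ' hf hfb s x
    rwa [hKt] at h
  -- the weight `e^{2θH} ρ` is integrable
  have hwt : Integrable (fun x => Real.exp (2 * θ * P.hamiltonian N x) * ρ x) :=
    pinnedChain_integrable_exp_mul_gibbsDensity hω hl hβ γ N hT h2θ
  -- integrability of `H(x,y) = w(x) ρ(x) f(y)` for `dx ⊗ P_s`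
  set Hf : PhaseSpace N × PhaseSpace N → ℝ := fun p => w p.1 * ρ p.1 * f p.2 with hHf
  have hHfc : Continuous Hf := by
    simp only [hHf]
    exact ((hw.comp continuous_fst).mul (hρc.comp continuous_fst)).mul (hf.comp continuous_snd)
  have hPf : StronglyMeasurable fun x => ∫ y, |f y| ∂(K x) :=
    (continuous_abs.comp hf).stronglyMeasurable.integral_kernel (κ := K)
  have hbound : ∀ x, |w x| * ρ x * ∫ y, |f y| ∂(K x) ≤
      Cw * Cf * cst * (Real.exp (2 * θ * P.hamiltonian N x) * ρ x) := by
    intro x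
    have h1 := hwb x
    have h2 := (h34 x).2
    have h3 : 0 ≤ ∫ y, |f y| ∂(K x) := integral_nonneg fun y => abs_nonneg _
    calc |w x| * ρ x * ∫ y, |f y| ∂(K x)
        ≤ (Cw * Real.exp (θ * P.hamiltonian N x)) * ρ x * (Cf * cst * Real.exp (θ * P.hamiltonian N x)) :=
          mul_le_mul (mul_le_mul_of_nonneg_right h1 (hρ0 x)) h2 h3
            (mul_nonneg (mul_nonneg hCw (Real.exp_pos _).le) (hρ0 x))
      _ = Cw * Cf * cst * ((Real.exp (θ * P.hamiltonian N x) * Real.exp (θ * P.hamiltonian N x)) * ρ x) := by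
          ring
      _ = Cw * Cf * cst * (Real.exp (2 * θ * P.hamiltonian N x) * ρ x) := by
          rw [← Real.exp_add]; ring_nf
  have hnorm : ∀ x y, ‖Hf (x, y)‖ = |w x| * ρ x * |f y| := fun x y => by
    simp only [hHf, norm_mul, Real.norm_eq_abs, abs_of_nonneg (hρ0 x)]
  have hHint : Integrable Hf ((volume : Measure (PhaseSpace N)) ⊗ₘ K) := by
    rw [Measure.integrable_compProd_iff hHfc.aestronglyMeasurable]
    refine ⟨Eventually.of_forall fun x => ?_, ?_⟩
    · simp only [hHf]
      exact (h34 x).1.const_mul (w x * ρ x)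
    · have e : (fun x => ∫ y, ‖Hf (x, y)‖ ∂(K x)) = fun x => |w x| * ρ x * ∫ y, |f y| ∂(K x) := by
        funext x
        simp_rw [hnorm x]
        exact integral_const_mul _ _
      rw [e]
      refine (hwt.const_mul (Cw * Cf * cst)).mono'
        (((continuous_abs.comp hw).mul hρc).aestronglyMeasurable.mul hPf.aestronglyMeasurable)
        (Eventually.of_forall fun x => ?_)
      rw [Real.norm_of_nonneg (mul_nonneg (mul_nonneg (abs_nonneg _) (hρ0 x))
        (integral_nonneg fun y => abs_nonneg _))]
      exact hbound x
  -- duality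
  obtain ⟨hswap, hdual⟩ := hP.integral_langevinKernel_duality T_L T_R (pinnedChain_contDiff_U ω₂ lam β γ)
    (pinnedChain_contDiff_V ω₂ lam β γ) hN hs hHint
  rw [← hK, ← hKr] at hdual
  have hPγ : P.γ = γ := rfl
  -- (i): integrability of `|f| P̂_s(|w| ρ)` from the integrability of the swapped function
  have hi : Integrable (fun y => |f y| * ∫ x, |w x| * ρ x ∂(Kr y)) := by
    have h1 := ((Measure.integrable_compProd_iff hswap.aestronglyMeasurable).1 hswap).2
    refine h1.congr (Eventually.of_forall fun y => ?_)
    show ∫ x, ‖Hf ((y, x) : PhaseSpace N × PhaseSpace N).swap‖ ∂(Kr y) = |f y| * ∫ x, |w x| * ρ x ∂(Kr y)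
    simp only [Prod.swap_prod_mk, hnorm]
    rw [← integral_const_mul]
    exact integral_congr_ae (Eventually.of_forall fun x => by ring)
  -- (iii): the identity
  have hiii : ∫ x, w x * ρ x * (∫ y, f y ∂(K x)) = Real.exp (2 * γ * s) * ∫ y, f y * ∫ x, w x * ρ x ∂(Kr y) := by
    have e1 : ∀ x, ∫ y, Hf (x, y) ∂(K x) = w x * ρ x * ∫ y, f y ∂(K x) := fun x => by
      simp only [hHf]; exact integral_const_mul _ _
    have e2 : ∀ y, ∫ x, Hf (x, y) ∂(Kr y) = f y * ∫ x, w x * ρ x ∂(Kr y) := fun y => by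
      simp only [hHf]; rw [integral_mul_const, mul_comm]
    simp_rw [e1, e2, hPγ] at hdual
    exact hdual
  refine ⟨hi, ?_, ?_⟩
  · -- (ii): apply (iii) to `|w|`, `|f|` and bound the forward side by (3.4)
    have hHa : Integrable (fun p : PhaseSpace N × PhaseSpace N => |w p.1| * ρ p.1 * |f p.2|)
        ((volume : Measure (PhaseSpace N)) ⊗ₘ K) := by
      refine hHint.norm.congr (Eventually.of_forall fun p => ?_)
      exact hnorm p.1 p.2
    obtain ⟨-, hduala⟩ := hP.integral_langevinKernel_duality T_L T_R (pinnedChain_contDiff_U ω₂ lam β γ)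
      (pinnedChain_contDiff_V ω₂ lam β γ) hN hs hHa
    rw [← hK, ← hKr] at hduala
    have e1 : ∀ x, ∫ y, |w x| * ρ x * |f y| ∂(K x) = |w x| * ρ x * ∫ y, |f y| ∂(K x) := fun x =>
      integral_const_mul _ _
    have e2 : ∀ y, ∫ x, |w x| * ρ x * |f y| ∂(Kr y) = |f y| * ∫ x, |w x| * ρ x ∂(Kr y) := fun y => by
      rw [integral_mul_const, mul_comm]
    simp_rw [e1, e2, hPγ] at hduala
    have hexp : Real.exp (-(2 * γ * s)) * Real.exp (2 * γ * s) = 1 := by rw [← Real.exp_add]; simp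
    have hle : ∫ x, |w x| * ρ x * ∫ y, |f y| ∂(K x) ≤
        Cw * Cf * cst * ∫ x, Real.exp (2 * θ * P.hamiltonian N x) * ρ x := by
      rw [← integral_const_mul]
      exact integral_mono_of_nonneg (Eventually.of_forall fun x => mul_nonneg (mul_nonneg (abs_nonneg _)
        (hρ0 x)) (integral_nonneg fun y => abs_nonneg _)) (hwt.const_mul _) (Eventually.of_forall hbound)
    calc ∫ y, |f y| * ∫ x, |w x| * ρ x ∂(Kr y)
        = Real.exp (-(2 * γ * s)) * (Real.exp (2 * γ * s) * ∫ y, |f y| * ∫ x, |w x| * ρ x ∂(Kr y)) := by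
          rw [← mul_assoc, hexp, one_mul]
      _ = Real.exp (-(2 * γ * s)) * ∫ x, |w x| * ρ x * ∫ y, |f y| ∂(K x) := by rw [hduala]
      _ ≤ Real.exp (-(2 * γ * s)) * (Cw * Cf * cst * ∫ x, Real.exp (2 * θ * P.hamiltonian N x) * ρ x) :=
          mul_le_mul_of_nonneg_left hle (Real.exp_pos _).le
  · rw [hKt]
    exact hiii

end Pinned

/-- **Registered sub-goal `gibbsTTCF_gibbsDuality`** of crux stmt-AtomisticToContinuum-11812 (under `stub_gibbsTTCF`, line
`gibbs-ttcf`): `pinnedChain_gibbs_duality` as a closed statement (`ω₂ > 0`, `lam, β, γ ≥ 0`, `N ≥ 1`, `T_L, T_R, T > 0`,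
`0 < θ < 1/max(T_L,T_R)`, `2θ < 1/T`, continuous `|w| ≤ C_w e^{θH}`, `|f| ≤ C_f e^{θH}`, `s > 0`). [folklore] -/
theorem gibbsTTCF_gibbsDuality :
    ∀ ω₂ lam β γ : ℝ, 0 < ω₂ → 0 ≤ lam → 0 ≤ β → 0 ≤ γ → ∀ N : ℕ, 0 < N → ∀ T_L T_R T θ Cw Cf : ℝ, 0 < T_L → 0 < T_R → 0 < T → 0 < θ → θ < 1 / max T_L T_R → 2 * θ < 1 / T → ∀ w f : PhaseSpace N → ℝ, Continuous w → Continuous f → (∀ x, |w x| ≤ Cw * Real.exp (θ * (pinnedChain ω₂ lam β γ).hamiltonian N x)) → (∀ y, |f y| ≤ Cf * Real.exp (θ * (pinnedChain ω₂ lam β γ).hamiltonian N y)) → ∀ s : ℝ≥0, 0 < s → Integrable (fun y => |f y| * ∫ x, |w x| * (pinnedChain ω₂ lam β γ).gibbsDensity N T x ∂((pinnedChain ω₂ lam β γ).langevinRevKernel N T_L T_R s y)) ∧ (∫ y, |f y| * ∫ x, |w x| * (pinnedChain ω₂ lam β γ).gibbsDensity N T x ∂((pinnedChain ω₂ lam β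 γ).langevinRevKernel N T_L T_R s y)) ≤ Real.exp (-(2 * γ * s)) * (Cw * Cf * Real.exp (θ * γ * (T_L + T_R) * s) * ∫ x, Real.exp (2 * θ * (pinnedChain ω₂ lam β γ).hamiltonian N x) * (pinnedChain ω₂ lam β γ).gibbsDensity N T x) ∧ ∫ x, w x * (pinnedChain ω₂ lam β γ).gibbsDensity N T x * (∫ y, f y ∂((pinnedChain ω₂ lam β γ).transitionKernel N T_L T_R s x)) = Real.exp (2 * γ * s) * ∫ y, f y * ∫ x, w x * (pinnedChain ω₂ lam β γ).gibbsDensity N T x ∂((pinnedChain ω₂ lam β γ).langevinRevKernel N T_L T_R s y) :=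
  fun _ _ _ _ hω hl hβ hγ _ hN _ _ _ _ _ _ hTL hTR hT hθ hθ' h2θ _ _ hw hf hwb hfb _ hs =>
    pinnedChain_gibbs_duality hω hl hβ hγ hN hTL hTR hT hθ hθ' h2θ hw hf hwb hfb hs

end Summit.AtomisticToContinuum.FouriersLaw.Theorems.BoundaryKubo.GibbsTtcf

end
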